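import Literature.NumberTheory.Automorphic.CongruenceSubgroupPropertySL2Symbol
import Literature.NumberTheory.Automorphic.CongruenceSubgroupPropertySL2AwayLemma2
import HarnessLib

/-!
# Serre's congruence subgroup property for `SL₂(ℤ[1/m])` — proofs, A-IV: Liehl's (8)–(11) (Cases 1–3)
# over `A = ℤ[1/m]`

Topic `Literature/NumberTheory/Automorphic`; namespace `Literature.NumberTheory.Automorphic.SL2Rel.Away`.
Everything here is PROVED; no definitions, no named facts.

This file ports the `section NumberField` parts of files XV–XVI of the tree's `𝓞_F` story
(`CongruenceSubgroupPropertySL2SymbolSq.lean`, `…SymbolMul.lean`) to `A = ℤ[1/m]`, `m ≥ 2`, for the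
symbol `[b over a] = SL2Rel.sym 𝔮 a b ∈ G(𝔮, A) ⧸ ncl E(𝔮, A)` of file XIV (defined over any
commutative ring): **Liehl (8)** `[b over a] = [y²b over a]` for `a - 1 ∈ 𝔮y²`
(`SL2Rel.Away.sym_sq_mul_eq`), **(9)** `α⁻¹ w⁻¹ α w ∈ E(I, I)` for `α ∈ G(I, I)`
(`weyl_commutator_mem_relE`), **(10)** `[dx over a] = [-ax over d]` (`sym_mul_eq_sym_neg_mul`), and
**(11), Cases 1–3** (`sym_mul_sym_eq_sym`, `sym_case_end`, `sym_case1`, `sym_case2`, `sym_case3`) — the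
tree's proofs verbatim, with Vaserstein's Lemmas 1, 2, 4 for `ℤ[1/m]` (files A-II, A-III) and, where the
printed argument conjugates inside `SL₂(k)`, the field of fractions `FractionRing A`.

## References

* [Liehl1981SL2Orders] B. Liehl, J. reine angew. Math. 323 (1981) 153–171, §3 (8)–(11).
* [Vaserstein1972SL2] L. N. Vaserstein, Mat. Sb. 89 (131) (1972) 313–322, Lemma 3.
* [SerreSL2Congruence1970] J.-P. Serre, Ann. of Math. 92 (1970), §2.6 (`K = ℚ`).
-/

open Matrix MatrixGroups

namespace Literature.NumberTheory.Automorphic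

namespace SL2Rel

namespace Away

section Liehl

variable {m : ℕ} {F : Type*} [Field F] [Algebra (Localization.Away (m : ℤ)) F]
  [IsFractionRing (Localization.Away (m : ℤ)) F]

/-! ### Liehl's (8), (9), (10) over `ℤ[1/m]` -/

/-- Membership in `E(I₁, I₂)` can be tested in `SL₂(F)`, `F` the field of fractions of `A = ℤ[1/m]`.
[cite: Liehl1981SL2Orders, §3 (8) (proof)] -/
theorem mem_relE_of_map_mem {I₁ I₂ : Ideal (Localization.Away (m : ℤ))} {M : SL(2, Localization.Away (m : ℤ))}
    (h : SpecialLinearGroup.map (algebraMap (Localization.Away (m : ℤ)) F) M ∈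
      (relE I₁ I₂).map (SpecialLinearGroup.map (algebraMap (Localization.Away (m : ℤ)) F))) : M ∈ relE I₁ I₂ := by
  obtain ⟨N, hN, hNM⟩ := Subgroup.mem_map.1 h
  rwa [← map_injective (algebraMap (Localization.Away (m : ℤ)) F) (IsFractionRing.injective (Localization.Away (m : ℤ)) F) hNM]


omit [IsFractionRing (Localization.Away (m : ℤ)) F] in
/-- Conjugation by `g = diag(y, y⁻¹) ∈ SL₂(F)` maps `E(𝔮, y²A)` into `E(𝔮, A)` (`g E₁₂(x) g⁻¹ = E₁₂(y²x)`,
`g E₂₁(cy²) g⁻¹ = E₂₁(c)`). [cite: Liehl1981SL2Orders, §3 (8) (proof)] -/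
theorem exists_relE_map_eq_diag_conj {𝔮 : Ideal (Localization.Away (m : ℤ))} {y : Localization.Away (m : ℤ)}
    (hy : algebraMap (Localization.Away (m : ℤ)) F y ≠ 0) {M : SL(2, Localization.Away (m : ℤ))} (hM : M ∈ relE 𝔮 (Ideal.span {y * y})) :
    ∃ M' ∈ relE 𝔮 ⊤, SpecialLinearGroup.map (algebraMap (Localization.Away (m : ℤ)) F) M' =
      diagHom (Units.mk0 _ hy) * SpecialLinearGroup.map (algebraMap (Localization.Away (m : ℤ)) F) M *
        (diagHom (Units.mk0 _ hy))⁻¹ := by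
  set f := algebraMap (Localization.Away (m : ℤ)) F with hf
  set g : SL(2, F) := diagHom (Units.mk0 _ hy) with hg
  refine Subgroup.closure_induction (p := fun M _ ↦ ∃ M' ∈ relE 𝔮 ⊤,
    SpecialLinearGroup.map f M' = g * SpecialLinearGroup.map f M * g⁻¹) ?_ ?_ ?_ ?_ hM
  · rintro _ (⟨x, hx, rfl⟩ | ⟨c, hc, rfl⟩)
    · refine ⟨e12 (y * y * x), e12_mem_relE (𝔮.mul_mem_left _ hx), ?_⟩
      rw [map_e12, map_e12, hg, diagHom_conj_e12, Units.val_mk0, map_mul, map_mul]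
    · rw [SetLike.mem_coe] at hc
      obtain ⟨c', rfl⟩ := Ideal.mem_span_singleton'.1 hc
      refine ⟨e21 c', e21_mem_relE Submodule.mem_top, ?_⟩
      rw [map_e21, map_e21, hg, diagHom_conj_e21, Units.val_inv_eq_inv_val, Units.val_mk0,
        map_mul, map_mul]
      congr 1
      field_simp
  · exact ⟨1, one_mem _, by simp⟩
  · rintro M N - - ⟨M', hM', hM'eq⟩ ⟨N', hN', hN'eq⟩
    refine ⟨M' * N', mul_mem hM' hN', ?_⟩
    rw [map_mul, hM'eq, hN'eq, map_mul]; group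
  · rintro M - ⟨M', hM', hM'eq⟩
    refine ⟨M'⁻¹, inv_mem hM', ?_⟩
    rw [map_inv, hM'eq, map_inv]; group

variable (hm : 2 ≤ m)
include hm

/-- **Liehl (8)** for the pair `(𝔮, A)`: if `a - 1 ∈ 𝔮y²`, `b ∈ 𝔮`, `(a, b) = 1` then
`[b over a] = [y²b over a]`.  Proof as printed: `g = diag(y, y⁻¹)`; by (4) an ideal `I'` with
`β⁻¹gβg⁻¹ ∈ E(𝔮, A)` for `β ∈ G(I', I')`; complete `(a, b)` to `α ∈ G(𝔮, y²A)`, write `α = βε` by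
(2); then `α⁻¹gαg⁻¹ ∈ E(𝔮, A)` and `gαg⁻¹` has first row `(a, y²b)`. [cite: Liehl1981SL2Orders, §3 (8)] -/
theorem sym_sq_mul_eq {𝔮 : Ideal (Localization.Away (m : ℤ))} (h𝔮 : 𝔮 ≠ ⊥) (y : Localization.Away (m : ℤ)) {a b : Localization.Away (m : ℤ)}
    (ha : a - 1 ∈ 𝔮 * Ideal.span {y * y}) (hb : b ∈ 𝔮) (hab : IsCoprime a b) :
    sym 𝔮 a (y * y * b) = sym 𝔮 a b := by
  have hm0 : m ≠ 0 := by omega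
  haveI := SL2Rel.isDomain_away hm0
  haveI := SL2Rel.isDedekindDomain_away hm0
  by_cases hy0 : y = 0
  · have ha1 : a = 1 := by
      rw [hy0, mul_zero, Ideal.span_singleton_zero, Ideal.mul_bot, Ideal.mem_bot, sub_eq_zero] at ha
      exact ha
    rw [ha1, hy0, zero_mul, zero_mul, sym_one_zero, sym_one_left hb]
  set f := algebraMap (Localization.Away (m : ℤ)) (FractionRing (Localization.Away (m : ℤ))) with hf
  have hinj := map_injective f (IsFractionRing.injective (Localization.Away (m : ℤ)) (FractionRing (Localization.Away (m : ℤ))))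
  have hy : f y ≠ 0 := fun h ↦ hy0 (IsFractionRing.injective (Localization.Away (m : ℤ)) (FractionRing (Localization.Away (m : ℤ))) (by rw [h, map_zero]))
  set g : SL(2, (FractionRing (Localization.Away (m : ℤ)))) := diagHom (Units.mk0 _ hy) with hg
  have ha𝔮 : a - 1 ∈ 𝔮 := Ideal.mul_le_right ha
  -- complete `(a, b)` to `α ∈ G(𝔮, y²A)`
  obtain ⟨α, hα, h0, h1⟩ := exists_relG_of_row ha hb hab
  set I : Ideal (Localization.Away (m : ℤ)) := 𝔮 * Ideal.span {y * y} with hI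
  have hI0 : I ≠ ⊥ :=
    mul_ne_zero h𝔮 (by rw [Ne, Ideal.zero_eq_bot, Ideal.span_singleton_eq_bot]; exact mul_ne_zero hy0 hy0)
  -- (4) for `g` and `I`; (2): `β = αε ∈ G(I', I')`
  obtain ⟨I', hI', hI'I, h4⟩ := exists_forall_relG_conj_mem hm g hI0
  obtain ⟨ε, hε, hβ⟩ := exists_mul_relE_mem_relG hI' (hI'I.trans Ideal.mul_le_right) hα
  -- `α⁻¹ g α g⁻¹ ∈ E(𝔮, A)` (inside `SL₂(F)`)
  set H := (relE 𝔮 ⊤).map (SpecialLinearGroup.map f) with hH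
  have hEI : relE I I ≤ relE 𝔮 ⊤ := relE_mono Ideal.mul_le_right le_top
  have hmem : (SpecialLinearGroup.map f α)⁻¹ * g * SpecialLinearGroup.map f α * g⁻¹ ∈ H := by
    obtain ⟨M₁, hM₁, hM₁eq⟩ := exists_relE_map_eq_diag_conj hy (inv_mem hε)
    rw [← hg] at hM₁eq
    have e : (SpecialLinearGroup.map f α)⁻¹ * g * SpecialLinearGroup.map f α * g⁻¹ =
        SpecialLinearGroup.map f ε *
          ((SpecialLinearGroup.map f (α * ε))⁻¹ * g * SpecialLinearGroup.map f (α * ε) * g⁻¹) *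
          (g * SpecialLinearGroup.map f ε⁻¹ * g⁻¹) := by
      rw [map_mul, map_inv]; group
    rw [e, ← hM₁eq]
    refine mul_mem (mul_mem (Subgroup.mem_map_of_mem _ (relE_mono le_rfl le_top hε)) ?_)
      (Subgroup.mem_map_of_mem _ hM₁)
    exact Subgroup.map_mono hEI (h4 _ hβ)
  obtain ⟨M₀, hM₀, hM₀eq⟩ := Subgroup.mem_map.1 hmem
  -- `g α g⁻¹` is the integral matrix `α' = (a, y²b; c/y², d)`
  obtain ⟨c', hc'⟩ := Ideal.mem_span_singleton'.1 hα.2.1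
  have hdet : a * α 1 1 - y * y * b * c' = 1 := by
    have := det_two α
    rw [h0, h1, ← hc'] at this
    linear_combination this
  set α' : SL(2, Localization.Away (m : ℤ)) := ⟨!![a, y * y * b; c', α 1 1], by rw [Matrix.det_fin_two_of]; exact hdet⟩
    with hα'
  have hα'G : α' ∈ relG 𝔮 ⊤ := by
    refine ⟨𝔮.mul_mem_left _ hb, Submodule.mem_top, by rw [Ideal.mul_top]; exact ha𝔮, ?_⟩
    rw [Ideal.mul_top]
    exact Ideal.mul_le_right (hα.2.2.2 : α 1 1 - 1 ∈ 𝔮 * Ideal.span {y * y})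
  have hgα : SpecialLinearGroup.map f α' = g * SpecialLinearGroup.map f α * g⁻¹ := by
    obtain ⟨k00, k01, k10, k11⟩ := diagHom_conj_apply (Units.mk0 _ hy) (SpecialLinearGroup.map f α)
    rw [← hg] at k00 k01 k10 k11
    ext i j
    fin_cases i <;> fin_cases j <;> simp only [Fin.zero_eta, Fin.isValue, Fin.mk_one]
    · rw [k00, map_apply_two, map_apply_two, h0]; rfl
    · rw [k01, map_apply_two, map_apply_two, h1, Units.val_mk0]
      show f (y * y * b) = _
      rw [map_mul, map_mul]
    · rw [k10, map_apply_two, map_apply_two, ← hc', Units.val_inv_eq_inv_val, Units.val_mk0]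
      show f c' = _
      rw [map_mul, map_mul]; field_simp
    · rw [k11, map_apply_two, map_apply_two]; rfl
  have hαM : α' = α * M₀ := by
    apply hinj
    rw [hgα, map_mul, hM₀eq]; group
  -- conclude
  have hαG : α ∈ relG 𝔮 ⊤ := relG_mono le_rfl le_top hα
  rw [sym_eq_mk ⟨α', hα'G⟩ (a := a) (b := y * y * b) rfl rfl, sym_eq_mk ⟨α, hαG⟩ h0 h1]
  have e : (⟨α', hα'G⟩ : relG 𝔮 ⊤) = ⟨α, hαG⟩ * ⟨M₀, relE_le_relG _ _ hM₀⟩ := Subtype.ext hαM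
  rw [e]
  exact mk_mul_eq_of_mem_relE _ _ hM₀

/-- **Liehl (9)**: `α⁻¹ w⁻¹ α w ∈ E(I, I)` for `α ∈ G(I, I)`, `w = (0 -1; 1 0)` ("in the same
fashion" as (8): (4) for `w⁻¹`, (2), and `w⁻¹ E(I, I) w = E(I, I)`). [cite: Liehl1981SL2Orders, §3 (9)] -/
theorem weyl_commutator_mem_relE {I : Ideal (Localization.Away (m : ℤ))} (hI : I ≠ ⊥) {α : SL(2, Localization.Away (m : ℤ))}
    (hα : α ∈ relG I I) : α⁻¹ * weylElt⁻¹ * α * weylElt ∈ relE I I := by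
  have hm0 : m ≠ 0 := by omega
  haveI := SL2Rel.isDomain_away hm0
  haveI := SL2Rel.isDedekindDomain_away hm0
  set f := algebraMap (Localization.Away (m : ℤ)) (FractionRing (Localization.Away (m : ℤ))) with hf
  set h : SL(2, (FractionRing (Localization.Away (m : ℤ)))) := SpecialLinearGroup.map f weylElt⁻¹ with hh
  obtain ⟨I', hI', hI'I, h4⟩ := exists_forall_relG_conj_mem hm h hI
  obtain ⟨ε, hε, hβ⟩ := exists_mul_relE_mem_relG hI' hI'I hα
  have e : α⁻¹ * weylElt⁻¹ * α * weylElt =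
      ε * ((α * ε)⁻¹ * weylElt⁻¹ * (α * ε) * weylElt) * (weylElt⁻¹ * ε⁻¹ * weylElt) := by group
  rw [e]
  refine mul_mem (mul_mem hε ?_) (weylElt_inv_conj_mem_relE (inv_mem hε))
  apply mem_relE_of_map_mem (F := FractionRing (Localization.Away (m : ℤ)))
  have := h4 _ hβ
  rw [hh, map_inv, inv_inv] at this
  simpa only [map_mul, map_inv] using this

/-- The chain of (6) and (8) in Mennicke's proof of (10): for `x ∈ 𝔮`, `a - 1 = x²s`,
`d - 1 ∈ x²A`, `d - a = x²e`, `(a, d) = 1`: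
`[dx over a] = [dx over a'] = [x²b'' over a'] = [b'' over a'] = [b'' over d] = [xe over d]`,
`a' = a - sdx²`, `b'' = xe + sdx`. [cite: Liehl1981SL2Orders, §3 (10) (proof)] -/
theorem sym_mul_eq_sym_mul_aux {𝔮 : Ideal (Localization.Away (m : ℤ))} (h𝔮 : 𝔮 ≠ ⊥) {x a d s e : Localization.Away (m : ℤ)} (hx : x ∈ 𝔮)
    (hs : a - 1 = x * x * s) (hd : d - 1 ∈ Ideal.span {x * x}) (he : d - a = x * x * e)
    (had : IsCoprime a d) : sym 𝔮 a (d * x) = sym 𝔮 d (x * e) := by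
  have ha𝔮 : a - 1 ∈ 𝔮 := by rw [hs]; exact 𝔮.mul_mem_right _ (𝔮.mul_mem_right _ hx)
  have hd𝔮 : d - 1 ∈ 𝔮 :=
    (Ideal.span_singleton_le_iff_mem _).2 (𝔮.mul_mem_right _ hx) hd
  have hax : IsCoprime a x := ⟨1, -(x * s), by linear_combination hs⟩
  have hadx : IsCoprime a (d * x) := had.mul_right hax
  have hdx : d * x ∈ 𝔮 := 𝔮.mul_mem_left _ hx
  set a' := a - s * d * x * x with ha'
  set b'' := x * e + s * d * x with hb''
  have hb''𝔮 : b'' ∈ 𝔮 := 𝔮.add_mem (𝔮.mul_mem_right _ hx) (𝔮.mul_mem_left _ hx)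
  -- `[dx over a] = [dx over a']`
  have ha'𝔮 : a' - 1 ∈ 𝔮 := by
    rw [show a' - 1 = (a - 1) + (-(s * x)) * (d * x) by rw [ha']; ring]
    exact 𝔮.add_mem ha𝔮 (𝔮.mul_mem_left _ hdx)
  have ha'dx : IsCoprime a' (d * x) := by
    rw [show a' = a + (d * x) * (-(s * x)) by rw [ha']; ring]
    exact hadx.add_mul_left_left _
  have h1 : sym 𝔮 a (d * x) = sym 𝔮 a' (d * x) := by
    rw [← sym_add_mul_left ha𝔮 hdx hadx (-(s * x)), ha']; ring_nf
  -- `[dx over a'] = [x²b'' over a']`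
  have hkey : d * x = x * x * b'' + x * a' := by
    rw [hb'', ha']; linear_combination x * he
  have ha'b : IsCoprime a' (x * x * b'') := by
    rw [show x * x * b'' = d * x + a' * (-x) by rw [hkey]; ring]
    exact ha'dx.add_mul_left_right _
  have h2 : sym 𝔮 a' (d * x) = sym 𝔮 a' (x * x * b'') := by
    rw [hkey]
    exact sym_add_mul_right ha'𝔮 (𝔮.mul_mem_left _ hb''𝔮) ha'b hx
  -- `[x²b'' over a'] = [b'' over a']` by (8)
  have ha'8 : a' - 1 ∈ 𝔮 * Ideal.span {x * x} := by
    rw [show a' - 1 = -(s * (d - 1)) * (x * x) by rw [ha']; linear_combination hs]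
    exact Ideal.mul_mem_mul (𝔮.neg_mem (𝔮.mul_mem_left _ hd𝔮)) (Ideal.mem_span_singleton_self _)
  have h3 : sym 𝔮 a' (x * x * b'') = sym 𝔮 a' b'' :=
    sym_sq_mul_eq hm h𝔮 x ha'8 hb''𝔮 ha'b.of_mul_right_right
  -- `[b'' over a'] = [b'' over d]` by (6): `d = a' + x b''`
  have h4 : sym 𝔮 a' b'' = sym 𝔮 d b'' := by
    rw [← sym_add_mul_left ha'𝔮 hb''𝔮 ha'b.of_mul_right_right x]
    congr 1
    rw [ha', hb'']; linear_combination -he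
  -- `[b'' over d] = [xe over d]` by (6): `b'' = xe + (sx) d`
  have hdb : IsCoprime d b'' := by
    have : IsCoprime (a' + x * b'') b'' := ha'b.of_mul_right_right.add_mul_right_left x
    convert this using 1
    rw [ha', hb'']; linear_combination he
  have hdxe : IsCoprime d (x * e) := by
    rw [show x * e = b'' + d * (-(s * x)) by rw [hb'']; ring]
    exact hdb.add_mul_left_right _
  have h5 : sym 𝔮 d b'' = sym 𝔮 d (x * e) := by
    rw [show b'' = x * e + (s * x) * d by rw [hb'']; ring]
    exact sym_add_mul_right hd𝔮 (𝔮.mul_mem_right _ hx) hdxe (𝔮.mul_mem_left _ hx)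
  rw [h1, h2, h3, h4, h5]

/-- **Liehl (10)** for the pair `(𝔮, A)`: for `x ∈ 𝔮`, `a - 1, d - 1 ∈ x²A`, `(a, d) = 1`:
`[dx over a] = [-ax over d]`. [cite: Liehl1981SL2Orders, §3 (10)] -/
theorem sym_mul_eq_sym_neg_mul {𝔮 : Ideal (Localization.Away (m : ℤ))} (h𝔮 : 𝔮 ≠ ⊥) {x a d : Localization.Away (m : ℤ)} (hx : x ∈ 𝔮)
    (ha : a - 1 ∈ Ideal.span {x * x}) (hd : d - 1 ∈ Ideal.span {x * x}) (had : IsCoprime a d) :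
    sym 𝔮 a (d * x) = sym 𝔮 d (-(a * x)) := by
  obtain ⟨s, hs⟩ := Ideal.mem_span_singleton'.1 ha
  obtain ⟨s', hs'⟩ := Ideal.mem_span_singleton'.1 hd
  have he : d - a = x * x * (s' - s) := by linear_combination hs - hs'
  have he' : a - d = (-x) * (-x) * (-(s' - s)) := by linear_combination hs' - hs
  have h1 := sym_mul_eq_sym_mul_aux hm h𝔮 (x := x) (a := a) (d := d) (s := s)
    (e := s' - s) hx (by linear_combination -hs) hd he had
  have h2 := sym_mul_eq_sym_mul_aux hm h𝔮 (x := -x) (a := d) (d := a) (s := s')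
    (e := -(s' - s)) (𝔮.neg_mem hx) (by linear_combination -hs')
    (by rw [show -x * -x = x * x by ring]; exact ha) he' had.symm
  rw [show a * -x = -(a * x) by ring, show -x * -(s' - s) = x * (s' - s) by ring] at h2
  rw [h1, h2]
  -- `[xe over d] = [xe over a]` by (6): `d = a + x (xe)`
  have ha𝔮 : a - 1 ∈ 𝔮 := by
    rw [← hs]; exact 𝔮.mul_mem_left _ (𝔮.mul_mem_right _ hx)
  have haxe : IsCoprime a (x * (s' - s)) := by
    have h3 : IsCoprime a (d + a * (-1)) := had.add_mul_left_right _
    rw [show d + a * (-1) = x * (x * (s' - s)) by linear_combination he] at h3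
    exact h3.of_mul_right_right
  rw [← sym_add_mul_left ha𝔮 (𝔮.mul_mem_right _ hx) haxe x]
  congr 1
  linear_combination he


/-! ### Liehl's (11), Cases 1–3 over `ℤ[1/m]` -/

/-- **The first step of (11)**: for `(a, b₁) ∈ W(𝔮, A)` and `α₂ = (a b₂; c d) ∈ G(I, I)`,
`0 ≠ I ⊆ 𝔮`: `[b₁ over a][b₂ over a] = [a(b₁ - c) over ad - b₁b₂]`, because by (9)
`(d -c; -b₂ a) = w⁻¹ α₂ w ∈ α₂ E(I, I)`. [cite: Liehl1981SL2Orders, §3 (11) (proof)] -/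
theorem sym_mul_sym_eq_sym {𝔮 I : Ideal (Localization.Away (m : ℤ))} (hI : I ≠ ⊥) (hI𝔮 : I ≤ 𝔮) {a b₁ : Localization.Away (m : ℤ)}
    (ha : a - 1 ∈ 𝔮) (hb₁ : b₁ ∈ 𝔮) (hab₁ : IsCoprime a b₁) {α₂ : SL(2, Localization.Away (m : ℤ))}
    (hα₂ : α₂ ∈ relG I I) (h00 : α₂ 0 0 = a) :
    sym 𝔮 a b₁ * sym 𝔮 a (α₂ 0 1) =
      sym 𝔮 (a * α₂ 1 1 - b₁ * α₂ 0 1) (a * (b₁ - α₂ 1 0)) := by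
  haveI := SL2Rel.isDomain_away (show m ≠ 0 by omega)
  obtain ⟨α₁, h10, h11, hs1⟩ := exists_sym_eq_mk ha hb₁ hab₁
  have hα₂' : α₂ ∈ relG 𝔮 ⊤ := relG_mono hI𝔮 le_top hα₂
  obtain ⟨k00, k01, k10, k11⟩ := weylElt_inv_mul_mul_apply α₂
  set β : SL(2, Localization.Away (m : ℤ)) := weylElt⁻¹ * α₂ * weylElt with hβ
  have hβG : β ∈ relG 𝔮 ⊤ := by
    refine ⟨?_, Submodule.mem_top, ?_, ?_⟩
    · rw [k01]; exact 𝔮.neg_mem (hI𝔮 hα₂.2.1)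
    · rw [k00, Ideal.mul_top]; exact (Ideal.mul_le_right.trans hI𝔮) hα₂.2.2.2
    · rw [k11, Ideal.mul_top, h00]; exact ha
  have hβα : ((⟨β, hβG⟩ : relG 𝔮 ⊤) : SymbGroup 𝔮) = (⟨α₂, hα₂'⟩ : relG 𝔮 ⊤) := by
    have h9 := weyl_commutator_mem_relE hm hI hα₂
    rw [QuotientGroup.eq]
    apply Subgroup.subset_normalClosure
    rw [SetLike.mem_coe, Subgroup.mem_subgroupOf]
    show β⁻¹ * α₂ ∈ relE 𝔮 ⊤
    rw [show β⁻¹ * α₂ = (α₂⁻¹ * weylElt⁻¹ * α₂ * weylElt)⁻¹ by rw [hβ]; group]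
    exact inv_mem (relE_mono hI𝔮 le_top h9)
  rw [hs1, sym_eq_mk ⟨α₂, hα₂'⟩ h00 rfl, ← hβα, ← QuotientGroup.mk_mul]
  refine (sym_eq_mk (α₁ * ⟨β, hβG⟩) ?_ ?_).symm
  · simp only [Subgroup.coe_mul, mul_apply_two, h10, h11, k00, k10]; ring
  · simp only [Subgroup.coe_mul, mul_apply_two, h10, h11, k01, k11, h00]; ring

omit hm in
/-- `a ≡ 1 (mod zt)` gives `(a, z) = 1`. [folklore] -/
private theorem isCoprime_of_sub_one_mem {a z t : Localization.Away (m : ℤ)} (h : a - 1 ∈ Ideal.span {z * t}) :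
    IsCoprime a z := by
  obtain ⟨s, hs⟩ := Ideal.mem_span_singleton'.1 h
  exact ⟨1, -(s * t), by linear_combination -hs⟩

/-- **The common ending of Cases 1 and 2 of (11)**: for `a - 1, D - 1 ∈ z⁴A`, `D = ad - b`,
`(D, a) = (a, b) = 1`:  `[az² over D] = [-Dz² over a] = [z²b over a] = [b over a]` by (10), (6), (8).
[cite: Liehl1981SL2Orders, §3 (11) (proof, Case 1)] -/
theorem sym_case_end {𝔮 : Ideal (Localization.Away (m : ℤ))} {z : Localization.Away (m : ℤ)} (hz : z ∈ 𝔮) (hz0 : z ≠ 0) {a d b D : Localization.Away (m : ℤ)}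
    (ha : a - 1 ∈ Ideal.span {z * z * (z * z)}) (hD : D - 1 ∈ Ideal.span {z * z * (z * z)})
    (hDdef : D = a * d - b) (hb : b ∈ 𝔮) (hDa : IsCoprime D a) (hab : IsCoprime a b) :
    sym 𝔮 D (a * (z * z)) = sym 𝔮 a b := by
  haveI := SL2Rel.isDomain_away (show m ≠ 0 by omega)
  have h𝔮 : 𝔮 ≠ ⊥ := fun h ↦ hz0 (by rw [h] at hz; exact hz)
  have hzz : z * z ∈ 𝔮 := 𝔮.mul_mem_left _ hz
  have ha𝔮 : a - 1 ∈ 𝔮 :=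
    (Ideal.span_singleton_le_iff_mem _).2 (𝔮.mul_mem_left _ hzz) ha
  have haz : IsCoprime a z := isCoprime_of_sub_one_mem (t := z * (z * z)) (by simpa [mul_assoc] using ha)
  -- (10)
  have s1 : sym 𝔮 D (a * (z * z)) = sym 𝔮 a (-(D * (z * z))) :=
    sym_mul_eq_sym_neg_mul hm h𝔮 hzz hD ha hDa
  -- (6): `z²b = -Dz² + (z²d) a`
  have hazz : IsCoprime a (-(D * (z * z))) :=
    (hDa.symm.mul_right (haz.mul_right haz)).neg_right
  have s2 : sym 𝔮 a (z * z * b) = sym 𝔮 a (-(D * (z * z))) := by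
    rw [show z * z * b = -(D * (z * z)) + (z * z * d) * a by rw [hDdef]; ring]
    exact sym_add_mul_right ha𝔮 (𝔮.neg_mem (𝔮.mul_mem_left _ hzz)) hazz (𝔮.mul_mem_right _ hzz)
  -- (8)
  have ha8 : a - 1 ∈ 𝔮 * Ideal.span {z * z} := by
    obtain ⟨s, hs⟩ := Ideal.mem_span_singleton'.1 ha
    rw [← hs, show s * (z * z * (z * z)) = (s * (z * z)) * (z * z) by ring]
    exact Ideal.mul_mem_mul (𝔮.mul_mem_left _ hzz) (Ideal.mem_span_singleton_self _)
  have s3 : sym 𝔮 a (z * z * b) = sym 𝔮 a b := sym_sq_mul_eq hm h𝔮 z ha8 hb hab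
  rw [s1, ← s2, s3]

/-- **(11), Case 1**: `b₁ - c = x²`, `x = zx₁ ∈ zA`, so that `D - 1 = -b₂x²`:
`[ax² over D] = [az² over D]` by (8), then the common ending. [cite: Liehl1981SL2Orders, §3 (11) Case 1] -/
theorem sym_case1 {𝔮 : Ideal (Localization.Away (m : ℤ))} {z : Localization.Away (m : ℤ)} (hz : z ∈ 𝔮) (hz0 : z ≠ 0)
    {a d b₁ b₂ D x₁ : Localization.Away (m : ℤ)} (ha : a - 1 ∈ Ideal.span {z * z * (z * z)})
    (hb₂ : b₂ ∈ Ideal.span {z * z}) (hDeq : D - 1 = -(b₂ * (z * x₁ * (z * x₁))))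
    (hDdef : D = a * d - b₁ * b₂) (hb : b₁ * b₂ ∈ 𝔮) (hDa : IsCoprime D a)
    (hab : IsCoprime a (b₁ * b₂)) :
    sym 𝔮 D (a * (z * x₁ * (z * x₁))) = sym 𝔮 a (b₁ * b₂) := by
  haveI := SL2Rel.isDomain_away (show m ≠ 0 by omega)
  have h𝔮 : 𝔮 ≠ ⊥ := fun h ↦ hz0 (by rw [h] at hz; exact hz)
  have hzz : z * z ∈ 𝔮 := 𝔮.mul_mem_left _ hz
  obtain ⟨b₂', hb₂'⟩ := Ideal.mem_span_singleton'.1 hb₂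
  have haz : IsCoprime a z := isCoprime_of_sub_one_mem (t := z * (z * z)) (by simpa [mul_assoc] using ha)
  have hDz : IsCoprime D z := by
    refine isCoprime_of_sub_one_mem (t := -(b₂ * z * x₁ * x₁)) ?_
    rw [hDeq]; exact Ideal.mem_span_singleton'.2 ⟨1, by ring⟩
  -- (8) with `y = x₁`
  have hD8 : D - 1 ∈ 𝔮 * Ideal.span {x₁ * x₁} := by
    rw [hDeq, show -(b₂ * (z * x₁ * (z * x₁))) = (-(b₂ * (z * z))) * (x₁ * x₁) by ring]
    exact Ideal.mul_mem_mul (𝔮.neg_mem (𝔮.mul_mem_left _ hzz)) (Ideal.mem_span_singleton_self _)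
  have hDazz : IsCoprime D (a * (z * z)) := hDa.mul_right (hDz.mul_right hDz)
  have s0 : sym 𝔮 D (x₁ * x₁ * (a * (z * z))) = sym 𝔮 D (a * (z * z)) :=
    sym_sq_mul_eq hm h𝔮 x₁ hD8 (𝔮.mul_mem_left _ hzz) hDazz
  rw [show a * (z * x₁ * (z * x₁)) = x₁ * x₁ * (a * (z * z)) by ring, s0]
  -- the common ending
  refine sym_case_end hm hz hz0 ha ?_ hDdef hb hDa hab
  rw [hDeq, ← hb₂']
  exact Ideal.mem_span_singleton'.2 ⟨-(b₂' * x₁ * x₁), by ring⟩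

/-- **(11), Case 2**: `b₂ = x²` (and `b₂ ∈ z²A`), `E = b₁ - c ∈ z²A`, `D = 1 - b₂E = ad - b₁b₂`:
`[aE over D] = [z²aE over D] = [b₂z²aE over D] = [az² over D]` by (8), (8), (6), then the common
ending. [cite: Liehl1981SL2Orders, §3 (11) Case 2] -/
theorem sym_case2 {𝔮 : Ideal (Localization.Away (m : ℤ))} {z : Localization.Away (m : ℤ)} (hz : z ∈ 𝔮) (hz0 : z ≠ 0)
    {a d b₁ b₂ D x E : Localization.Away (m : ℤ)} (ha : a - 1 ∈ Ideal.span {z * z * (z * z)})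
    (hb₂ : b₂ ∈ Ideal.span {z * z}) (hx : b₂ = x * x) (hE : E ∈ Ideal.span {z * z})
    (hDeq : D = 1 - b₂ * E) (hDdef : D = a * d - b₁ * b₂) (hb : b₁ * b₂ ∈ 𝔮)
    (hDa : IsCoprime D a) (hab : IsCoprime a (b₁ * b₂)) :
    sym 𝔮 D (a * E) = sym 𝔮 a (b₁ * b₂) := by
  haveI := SL2Rel.isDomain_away (show m ≠ 0 by omega)
  have h𝔮 : 𝔮 ≠ ⊥ := fun h ↦ hz0 (by rw [h] at hz; exact hz)
  have hzz : z * z ∈ 𝔮 := 𝔮.mul_mem_left _ hz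
  have hI𝔮 : Ideal.span {z * z} ≤ 𝔮 := (Ideal.span_singleton_le_iff_mem _).2 hzz
  obtain ⟨E', hE'⟩ := Ideal.mem_span_singleton'.1 hE
  obtain ⟨b₂', hb₂'⟩ := Ideal.mem_span_singleton'.1 hb₂
  have hD𝔮 : D - 1 ∈ 𝔮 := by
    rw [hDeq, show 1 - b₂ * E - 1 = -(b₂ * E) by ring]
    exact 𝔮.neg_mem (𝔮.mul_mem_left _ (hI𝔮 hE))
  have hDE : IsCoprime D E := ⟨1, b₂, by rw [hDeq]; ring⟩
  have hDz : IsCoprime D z := by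
    refine isCoprime_of_sub_one_mem (t := -(b₂ * E' * z)) ?_
    rw [hDeq, ← hE']; exact Ideal.mem_span_singleton'.2 ⟨1, by ring⟩
  have hDaE : IsCoprime D (a * E) := hDa.mul_right hDE
  -- (8) with `y = z`
  have hD8 : D - 1 ∈ 𝔮 * Ideal.span {z * z} := by
    rw [hDeq, show 1 - b₂ * E - 1 = (-b₂) * E by ring, ← hE']
    exact Ideal.mul_mem_mul (𝔮.neg_mem (hI𝔮 hb₂)) (Ideal.mem_span_singleton'.2 ⟨E', rfl⟩)
  have s1 : sym 𝔮 D (z * z * (a * E)) = sym 𝔮 D (a * E) :=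
    sym_sq_mul_eq hm h𝔮 z hD8 (𝔮.mul_mem_left _ (hI𝔮 hE)) hDaE
  -- (8) with `y = x`
  have hD8' : D - 1 ∈ 𝔮 * Ideal.span {x * x} := by
    rw [hDeq, show 1 - b₂ * E - 1 = (-E) * (x * x) by rw [hx]; ring]
    exact Ideal.mul_mem_mul (𝔮.neg_mem (hI𝔮 hE)) (Ideal.mem_span_singleton_self _)
  have hDzaE : IsCoprime D (z * z * (a * E)) := (hDz.mul_right hDz).mul_right hDaE
  have s2 : sym 𝔮 D (x * x * (z * z * (a * E))) = sym 𝔮 D (z * z * (a * E)) :=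
    sym_sq_mul_eq hm h𝔮 x hD8' (𝔮.mul_mem_left _ (𝔮.mul_mem_left _ (hI𝔮 hE))) hDzaE
  -- (6): `az² = x²z²aE + (az²) D`
  have hDb₂ : IsCoprime D b₂ := ⟨1, E, by rw [hDeq]; ring⟩
  have hDall : IsCoprime D (x * x * (z * z * (a * E))) := by rw [← hx]; exact hDb₂.mul_right hDzaE
  have s3 : sym 𝔮 D (a * (z * z)) = sym 𝔮 D (x * x * (z * z * (a * E))) := by
    rw [show a * (z * z) = x * x * (z * z * (a * E)) + (a * (z * z)) * D by rw [hDeq, hx]; ring]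
    exact sym_add_mul_right hD𝔮 (𝔮.mul_mem_left _ (𝔮.mul_mem_left _ (𝔮.mul_mem_left _ (hI𝔮 hE))))
      hDall (𝔮.mul_mem_left _ hzz)
  rw [← s1, ← s2, ← s3]
  refine sym_case_end hm hz hz0 ha ?_ hDdef hb hDa hab
  rw [hDeq, show 1 - b₂ * E - 1 = -(b₂ * E) by ring, ← hb₂', ← hE']
  exact Ideal.mem_span_singleton'.2 ⟨-(b₂' * E'), by ring⟩

omit hm in
/-- If `D = ad - m` with `(a, m) = 1` then `(D, a) = 1`. [folklore] -/
private theorem isCoprime_of_eq_sub {a d c D : Localization.Away (m : ℤ)} (hD : D = a * d - c) (hac : IsCoprime a c) :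
    IsCoprime D a := by
  have h : IsCoprime a (-c + a * d) := hac.neg_right.add_mul_left_right d
  rw [show -c + a * d = D by rw [hD]; ring] at h
  exact h.symm

/-- **(11), Case 3**: `(a, b₁), (a, b₂)` rows of `G(z²A, z²A)`, and `x₀, y₀ ∈ zA` with
`b₁b₂x₀² - y₀²x₀²b₂ + 1 ≡ 0 (mod a)`, `(a, x₀) = 1` (lifts of `b₂⁻¹uv⁻¹`, `wu⁻¹` for a solution of
`b₁u² + b₂v² ≡ w²`).  With `c' = b₁ - y₀²`, `d' = (c'b₂x₀² + 1)/a`, `(a, b₂x₀²; c', d') ∈ G(z²A, z²A)`;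
Case 1 gives `[b₁][b₂x₀²] = [b₁b₂x₀²]`, Case 2 gives `[b₂x₀²] = [b₂][x₀²]`, `[b₁b₂x₀²] = [b₁b₂][x₀²]`.
[cite: Liehl1981SL2Orders, §3 (11) Case 3] -/
theorem sym_case3 {𝔮 : Ideal (Localization.Away (m : ℤ))} {z : Localization.Away (m : ℤ)} (hz : z ∈ 𝔮) (hz0 : z ≠ 0) {a b₁ b₂ x₀ y₀ : Localization.Away (m : ℤ)}
    (ha : a - 1 ∈ Ideal.span {z * z * (z * z)}) (hb₁ : b₁ ∈ Ideal.span {z * z})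
    (hb₂ : b₂ ∈ Ideal.span {z * z}) (hab₁ : IsCoprime a b₁) (hab₂ : IsCoprime a b₂)
    (hx₀ : x₀ ∈ Ideal.span {z}) (hy₀ : y₀ ∈ Ideal.span {z})
    (hrel : b₁ * b₂ * x₀ * x₀ - y₀ * y₀ * x₀ * x₀ * b₂ + 1 ∈ Ideal.span {a})
    (hax₀ : IsCoprime a x₀) :
    sym 𝔮 a b₁ * sym 𝔮 a b₂ = sym 𝔮 a (b₁ * b₂) := by
  haveI := SL2Rel.isDomain_away (show m ≠ 0 by omega)
  have h𝔮 : 𝔮 ≠ ⊥ := fun h ↦ hz0 (by rw [h] at hz; exact hz)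
  have hzz : z * z ∈ 𝔮 := 𝔮.mul_mem_left _ hz
  set I : Ideal (Localization.Away (m : ℤ)) := Ideal.span {z * z} with hI
  have hI0 : I ≠ ⊥ := by rw [hI, Ne, Ideal.span_singleton_eq_bot]; exact mul_ne_zero hz0 hz0
  have hI𝔮 : I ≤ 𝔮 := (Ideal.span_singleton_le_iff_mem _).2 hzz
  have hII : I * I = Ideal.span {z * z * (z * z)} := Ideal.span_singleton_mul_span_singleton _ _
  have haII : a - 1 ∈ I * I := by rwa [hII]
  have ha𝔮 : a - 1 ∈ 𝔮 := (Ideal.mul_le_right.trans hI𝔮) haII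
  obtain ⟨x₁, hx₁⟩ := Ideal.mem_span_singleton'.1 hx₀
  obtain ⟨y₁, hy₁⟩ := Ideal.mem_span_singleton'.1 hy₀
  have hx₀₀ : x₀ * x₀ ∈ I := Ideal.mem_span_singleton'.2 ⟨x₁ * x₁, by rw [← hx₁]; ring⟩
  -- the matrix `(a, b₂x₀²; c', d')`
  set c' := b₁ - y₀ * y₀ with hc'
  have hc'I : c' ∈ I := I.sub_mem hb₁ (Ideal.mem_span_singleton'.2 ⟨y₁ * y₁, by rw [← hy₁]; ring⟩)
  obtain ⟨d', hd'⟩ := Ideal.mem_span_singleton'.1 hrel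
  have hdet : a * d' - b₂ * (x₀ * x₀) * c' = 1 := by rw [hc']; linear_combination hd'
  set α₂ : SL(2, Localization.Away (m : ℤ)) := ⟨!![a, b₂ * (x₀ * x₀); c', d'], by rw [Matrix.det_fin_two_of]; exact hdet⟩
    with hα₂
  have hα₂G : α₂ ∈ relG I I := by
    refine ⟨I.mul_mem_right _ hb₂, hc'I, haII, ?_⟩
    show d' - 1 ∈ I * I
    rw [show d' - 1 = -(d' * (a - 1)) + b₂ * (x₀ * x₀) * c' by linear_combination hdet]
    exact (I * I).add_mem ((I * I).neg_mem (Ideal.mul_mem_left _ _ haII))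
      (Ideal.mul_mem_mul (I.mul_mem_right _ hb₂) hc'I)
  -- Case 1: `[b₁][b₂x₀²] = [b₁b₂x₀²]`
  have hab₂x : IsCoprime a (b₂ * (x₀ * x₀)) := hab₂.mul_right (hax₀.mul_right hax₀)
  have E1 : sym 𝔮 a b₁ * sym 𝔮 a (b₂ * (x₀ * x₀)) = sym 𝔮 a (b₁ * (b₂ * (x₀ * x₀))) := by
    have h := sym_mul_sym_eq_sym hm hI0 hI𝔮 ha𝔮 (hI𝔮 hb₁) hab₁ hα₂G rfl
    simp only [hα₂] at h
    change sym 𝔮 a b₁ * sym 𝔮 a (b₂ * (x₀ * x₀)) =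
      sym 𝔮 (a * d' - b₁ * (b₂ * (x₀ * x₀))) (a * (b₁ - c')) at h
    rw [h, show b₁ - c' = z * y₁ * (z * y₁) by rw [hc', ← hy₁]; ring]
    have hDeq : a * d' - b₁ * (b₂ * (x₀ * x₀)) - 1 = -(b₂ * (x₀ * x₀) * (z * y₁ * (z * y₁))) := by
      rw [hc'] at hdet
      linear_combination hdet + (b₂ * (x₀ * x₀) * (z * y₁ + y₀)) * hy₁
    refine sym_case1 hm hz hz0 ha (I.mul_mem_right _ hb₂) hDeq rfl
      (𝔮.mul_mem_left _ (𝔮.mul_mem_right _ (hI𝔮 hb₂))) ?_ (hab₁.mul_right hab₂x)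
    exact isCoprime_of_eq_sub rfl (hab₁.mul_right hab₂x)
  -- Case 2: `[B][x₀²] = [Bx₀²]` for `B = b₂, b₁b₂`
  have E2 : ∀ B : Localization.Away (m : ℤ), B ∈ I → IsCoprime a B →
      sym 𝔮 a B * sym 𝔮 a (x₀ * x₀) = sym 𝔮 a (B * (x₀ * x₀)) := by
    intro B hBI haB
    obtain ⟨α₃, hα₃, h30, h31⟩ := exists_relG_of_row haII hx₀₀ (hax₀.mul_right hax₀)
    have h := sym_mul_sym_eq_sym hm hI0 hI𝔮 ha𝔮 (hI𝔮 hBI) haB hα₃ h30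
    rw [h31] at h
    rw [h]
    have hdet₃ : a * α₃ 1 1 - x₀ * x₀ * α₃ 1 0 = 1 := by
      have := det_two α₃; rwa [h30, h31] at this
    refine sym_case2 hm hz hz0 ha hx₀₀ rfl (I.sub_mem hBI hα₃.2.1) ?_ rfl
      (𝔮.mul_mem_right _ (hI𝔮 hBI)) ?_ (haB.mul_right (hax₀.mul_right hax₀))
    · linear_combination hdet₃
    · exact isCoprime_of_eq_sub rfl (haB.mul_right (hax₀.mul_right hax₀))
  have E2a := E2 b₂ hb₂ hab₂
  have E2b := E2 (b₁ * b₂) (I.mul_mem_left _ hb₂) (hab₁.mul_right hab₂)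
  -- together
  rw [mul_assoc] at E2b
  have : sym 𝔮 a b₁ * sym 𝔮 a b₂ * sym 𝔮 a (x₀ * x₀) = sym 𝔮 a (b₁ * b₂) * sym 𝔮 a (x₀ * x₀) := by
    rw [mul_assoc, E2a, E1, ← E2b]
  exact mul_right_cancel this

end Liehl

end Away

end SL2Rel

end Literature.NumberTheory.Automorphic
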